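import Summits.NavierStokesRegularity.NavierStokesRegularity.Theorems.AxisymmetricExtremalityAxisymmetricKatoGlobalStubSeregin2020TypeIILemma22MoserEmbedding
import Summits.NavierStokesRegularity.NavierStokesRegularity.Theorems.AxisTwistDoorAveragedConeLiouvilleNUMoserEnergy
import Summits.NavierStokesRegularity.NavierStokesRegularity.Theorems.AxisTwistDoorAveragedConeLiouvilleNUMoserLipTools
import Summits.NavierStokesRegularity.NavierStokesRegularity.Theorems.AxisTwistDoorAveragedConeLiouvilleNUWeakDerivLip
import HarnessLib

/-!
# Nazarov–Uraltseva 2011 §3 over LIPSCHITZ slices (T1 of cell pub/ns-inputs), piece M1ᴸ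
# (the axis-free Moser step over `NUStandingLip`) — the parabolic embedding of `w = η^{1/2}(l-Φ)₊^{q/2}φ³`

Lipschitz-slice TWIN of the landed `nu_moser_embedding_estimate` (`…NUMoserEmbedding.lean`, width seat
ns-in-wu-341 g2, p633639 chain): the slice hypothesis `∀ᵐ t ∈ ]-R²,0[, ContDiff ℝ 1 (Φ t)` is REPLACED by
the two clauses of `NUStandingLip` (`…NULipDefs`) «`∃ L, ∀ t, LipschitzWith L (Φ t)`» and
«`ContinuousOn (uncurry Φ) {z | z.1 < 0}`»; statement otherwise verbatim, proof verbatim except at the four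
points of ser-a g2's PORT MAP (`kits/N4-T1-plan.md` v2 §6): (a) the slice `w(s,·)` is Lipschitz
(`exists_lipschitzWith_wSlice`), hence weakly differentiable with weak gradient its a.e. `fderiv`
(`NU.hasWeakFDerivOn_of_lipschitz`, p637066), and the pointwise gradient bound holds at every point where
`Φ s` is differentiable (`sq_norm_fderiv_wSlice_le_of_differentiableAt`), i.e. product-a.e. — Rademacher
(`LipschitzWith.ae_differentiableAt`) slice by slice plus the measurability of the differentiability set
from the joint continuity on `{t < 0}` (`ae_prod_differentiableAt_slice_of_continuousOn`); (b) `L²`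
finiteness of the slices from Lipschitz ⇒ continuous; (c) joint a.e.-measurability of the slice gradient
from product-a.e. differentiability (`aestronglyMeasurable_fderiv_slice_of_ae_differentiableAt`); (d) the
embedding `parabolicEmbedding_of_hasWeakFDerivOn` (A1 `…Lemma22ParabolicEmbedding`) in place of
`parabolicEmbedding_of_contDiff`.  Seat ns-s29-p2 g4 (plan g6 key, pub/ns-inputs/STATUS 2026-08-28T13:50:14Z),
`--supports stmt-NavierStokesRegularity-26889 --as helper`.

## References

* A. I. Nazarov, N. N. Uraltseva, Algebra i Analiz 23:1 (2011) = St. Petersburg Math. J. 23 (2012) 93–115 =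
  arXiv:1011.1888, §3, Lemma 3.1, (3.2)–(3.6), Remarks 5, 9. [NazarovUraltseva2011HarnackDivFree] [NazarovUraltseva2012]
* Z. Lei, X. Ren, G. Tian, arXiv:2501.08976, Lemma 2.5. [LeiRenTian2025]

WHAT THIS IS NOT: not a statement about Navier–Stokes regularity; one brick of the re-proof of the INPUT
`NazarovUraltseva2011_positivity_propagation` (N4/T1) over Lipschitz generalized supersolutions; item 26889
and the summit stay open; nothing is closed by this file.
-/

-- the problem directory repeats the summit name (D-0017); core's `dupNamespace` linter fires
set_option linter.dupNamespace false

noncomputable section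

open MeasureTheory Set Function Filter Topology Metric
open scoped NNReal ENNReal RealInnerProductSpace

namespace Summit.NavierStokesRegularity.NavierStokesRegularity.Theorems.AveragedConeLiouville.NU

open Literature.Analysis.FluidPDE Literature.Analysis.FluidPDE.LeiZhang2011
open Summit.NavierStokesRegularity.NavierStokesRegularity.Theorems.AxisymmetricKatoGlobal.EulerScaling

-- build-lane heartbeat margin (the proof needs ≈ 150k–200k; the tree build lane failed at the default)
set_option maxHeartbeats 400000 in
/-- **The parabolic embedding of `w = η^{1/2}(l-Φ)₊^{q/2}φ³` (N–U (3.5) with `r = l = 10/3`), LIPSCHITZ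
slices.** Data as in `nu_moser_energy_bounds` plus: all slices `Φ t` are `L`-Lipschitz for one `L`, and
`uncurry Φ` is continuous on `{t < 0}`; conclusion:
`T = ∫∫_{]t₁,t₀[×ℝ³} w^{10/3}` is finite and `T ≤ 3 C_S² E^{5/3}`,
`E = (36 L_φ² + B_η) I₁ + ∫∫_{Q₁} 6 η (l-Φ)₊^q φ⁵ |U| ‖Dφ‖` (`parabolicEmbedding_of_hasWeakFDerivOn` with
the slice bounds of `nu_moser_energy_bounds`; the weak slice gradient is the a.e. `fderiv` of the Lipschitz
slice, `∇w = η^{1/2}(φ³∇v + v∇φ³)` and `‖∇w‖² ≤ η H''(Φ)‖∇Φ‖²Θ² + 18 η (l-Φ)₊^q ‖Dφ‖²` at a.e. point).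
[cite: NazarovUraltseva2012, proof of Lemma 3.1, (3.5) with r = l = 2(n+2)/n] -/
theorem nuLip_moser_embedding_estimate
    (Φ : ℝ → EuclideanSpace ℝ (Fin 3) → ℝ)
    (U : ℝ → EuclideanSpace ℝ (Fin 3) → EuclideanSpace ℝ (Fin 3)) (k R : ℝ)
    (hΦm : Measurable (uncurry Φ)) (hΦ0 : ∀ t x, 0 ≤ Φ t x)
    (hLip : ∃ L : ℝ≥0, ∀ t, LipschitzWith L (Φ t))
    (hcont : ContinuousOn (uncurry Φ) {z : ℝ × EuclideanSpace ℝ (Fin 3) | z.1 < 0})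
    (hU : AEStronglyMeasurable (uncurry U) volume)
    (hEC : ∀ (H : ℝ → ℝ), ContDiff ℝ 2 H → (∀ v, deriv H v ≤ 0) → (∀ v, 0 ≤ H v) →
      (∀ v, 0 ≤ deriv (deriv H) v) → (∀ v, deriv H v ^ 2 ≤ 2 * H v * deriv (deriv H) v) →
      (∀ v, k ≤ v → H v = 0) →
      ∀ (Θ : EuclideanSpace ℝ (Fin 3) → ℝ), ContDiff ℝ 1 Θ → HasCompactSupport Θ →
        tsupport Θ ⊆ ball (0 : EuclideanSpace ℝ (Fin 3)) (2 * R) →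
      ∀ (η : ℝ → ℝ), ContDiff ℝ 1 η → (∀ s, 0 ≤ η s) →
      ∀ (t₁ t₂ : ℝ), -R ^ 2 < t₁ → t₁ ≤ t₂ → t₂ < 0 →
        ENNReal.ofReal (η t₂ * ∫ x, H (Φ t₂ x) * Θ x ^ 2) +
          ∫⁻ z in Icc t₁ t₂ ×ˢ (univ : Set (EuclideanSpace ℝ (Fin 3))), ENNReal.ofReal
            (1 / 2 * η z.1 * (deriv (deriv H) (Φ z.1 z.2) * ‖gradient (Φ z.1) z.2‖ ^ 2 *
              Θ z.2 ^ 2))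
        ≤ ENNReal.ofReal (η t₁ * (∫ x, H (Φ t₁ x) * Θ x ^ 2) +
            (4 * ∫ z in Icc t₁ t₂ ×ˢ (univ : Set (EuclideanSpace ℝ (Fin 3))),
              η z.1 * (H (Φ z.1 z.2) * ‖gradient Θ z.2‖ ^ 2)) +
            (∫ z in Icc t₁ t₂ ×ˢ (univ : Set (EuclideanSpace ℝ (Fin 3))),
              η z.1 * (H (Φ z.1 z.2) * inner ℝ (U z.1 z.2) (gradient (fun y => Θ y ^ 2) z.2))) +
            (∫ z in Icc t₁ t₂ ×ˢ (univ : Set (EuclideanSpace ℝ (Fin 3))),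
              |deriv η z.1| * (H (Φ z.1 z.2) * Θ z.2 ^ 2))))
    {ρ₂ ρ₁ t₁ t₀ l q Lφ Bη : ℝ} (hρ₂ : 0 < ρ₂) (hρ₁ : ρ₂ < ρ₁) (hρ₁R : ρ₁ < 2 * R)
    (ht₁ : -R ^ 2 < t₁) (ht : t₁ < t₀) (ht₀ : t₀ ≤ 0) (hl : 0 < l) (hlk : l ≤ k) (hq : 2 < q)
    {φ : EuclideanSpace ℝ (Fin 3) → ℝ} (hφdef : φ = radialCutoff ρ₂ ρ₁)
    (hLφ : ∀ x, ‖fderiv ℝ φ x‖ ≤ Lφ)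
    {η : ℝ → ℝ} (hη : ContDiff ℝ 1 η) (hη01 : ∀ s, 0 ≤ η s ∧ η s ≤ 1) (hBη0 : 0 ≤ Bη)
    (hBη : ∀ s, |deriv η s| ≤ Bη)
    (hinit : η t₁ * (∫ x, max (l - Φ t₁ x) 0 ^ q * (φ x ^ 3) ^ 2) = 0) :
    (∫⁻ z in Ioo t₁ t₀ ×ˢ (univ : Set (EuclideanSpace ℝ (Fin 3))),
        ENNReal.ofReal ((η z.1 ^ ((1 : ℝ) / 2) * max (l - Φ z.1 z.2) 0 ^ (q / 2) * φ z.2 ^ 3) ^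
          ((10 : ℝ) / 3)) ≠ ∞) ∧
    ∫⁻ z in Ioo t₁ t₀ ×ˢ (univ : Set (EuclideanSpace ℝ (Fin 3))),
        ENNReal.ofReal ((η z.1 ^ ((1 : ℝ) / 2) * max (l - Φ z.1 z.2) 0 ^ (q / 2) * φ z.2 ^ 3) ^
          ((10 : ℝ) / 3)) ≤
      3 * (SNormLESNormFDerivOfEqConst ℝ (volume : Measure (EuclideanSpace ℝ (Fin 3))) 2 : ℝ≥0∞) ^ 2 *
        (ENNReal.ofReal (36 * Lφ ^ 2 + Bη) *
            (∫⁻ z in Ioo t₁ t₀ ×ˢ closedBall (0 : EuclideanSpace ℝ (Fin 3)) ρ₁,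
              ENNReal.ofReal (max (l - Φ z.1 z.2) 0 ^ q)) +
          ∫⁻ z in Ioo t₁ t₀ ×ˢ closedBall (0 : EuclideanSpace ℝ (Fin 3)) ρ₁,
            ENNReal.ofReal (6 * (η z.1 * max (l - Φ z.1 z.2) 0 ^ q) * φ z.2 ^ 5 *
              ‖U z.1 z.2‖ * ‖fderiv ℝ φ z.2‖)) ^ ((5 : ℝ) / 3) := by
  ----------------------------------------------------------------
  -- notation
  ----------------------------------------------------------------
  set CS : ℝ≥0∞ := (SNormLESNormFDerivOfEqConst ℝ (volume : Measure (EuclideanSpace ℝ (Fin 3))) 2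
    : ℝ≥0∞) with hCS
  set C₁ : ℝ≥0∞ := (3 * CS ^ 2) ^ ((3 : ℝ) / 5) with hC₁
  set K : Set (EuclideanSpace ℝ (Fin 3)) := closedBall (0 : EuclideanSpace ℝ (Fin 3)) ρ₁ with hK
  have hKm : MeasurableSet K := measurableSet_closedBall
  set Q₁ : Set (ℝ × EuclideanSpace ℝ (Fin 3)) := Ioo t₁ t₀ ×ˢ K with hQ₁
  have hQ₁m : MeasurableSet Q₁ := measurableSet_Ioo.prod hKm
  set Qu : Set (ℝ × EuclideanSpace ℝ (Fin 3)) := Ioo t₁ t₀ ×ˢ (univ : Set (EuclideanSpace ℝ (Fin 3)))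
    with hQu
  set V : ℝ × EuclideanSpace ℝ (Fin 3) → ℝ := fun z => max (l - Φ z.1 z.2) 0 with hV
  have hV0 : ∀ z, 0 ≤ V z := fun z => le_max_right _ _
  have hVm : Measurable V := (measurable_const.sub hΦm).max measurable_const
  have hVl : ∀ z, V z ≤ l := fun z => max_le (by linarith [hΦ0 z.1 z.2]) hl.le
  set w : ℝ × EuclideanSpace ℝ (Fin 3) → ℝ := fun z =>
    η z.1 ^ ((1 : ℝ) / 2) * V z ^ (q / 2) * φ z.2 ^ 3 with hw
  set g : ℝ × EuclideanSpace ℝ (Fin 3) → ℝ := fun z =>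
    3 * (η z.1 ^ ((1 : ℝ) / 6) * V z ^ (q / 6)) * ‖fderiv ℝ φ z.2‖ with hg
  set I₁ : ℝ≥0∞ := ∫⁻ z in Q₁, ENNReal.ofReal (V z ^ q) with hI₁
  set U₃ : ℝ≥0∞ := ∫⁻ z in Q₁, ‖U z.1 z.2‖ₑ ^ (3 : ℕ) with hU₃
  set E₀ : ℝ≥0∞ := ENNReal.ofReal (36 * Lφ ^ 2 + Bη) * I₁ with hE₀
  set DR : ℝ≥0∞ := ∫⁻ z in Q₁, ENNReal.ofReal (6 * (η z.1 * V z ^ q) * φ z.2 ^ 5 *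
    ‖U z.1 z.2‖ * ‖fderiv ℝ φ z.2‖) with hDR
  set E : ℝ≥0∞ := E₀ + DR with hE
  set T : ℝ≥0∞ := ∫⁻ z in Qu, ENNReal.ofReal (w z ^ ((10 : ℝ) / 3)) with hT
  set G : ℝ≥0∞ := (ENNReal.ofReal (729 * Lφ ^ 6) * I₁) ^ ((1 : ℝ) / 6) with hG
  -- cut-off facts
  obtain ⟨hΘ1, hΘc, hΘK, hφ01, -, -, -, -⟩ := moserTheta_props hρ₂.le hρ₁ hφdef
  have hφs : ContDiff ℝ 1 φ := by rw [hφdef]; exact radialCutoff_contDiff ρ₂ ρ₁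
  have hφc : Continuous φ := hφs.continuous
  have hφK : ∀ x, x ∉ K → φ x = 0 := fun x hx => by
    rw [hφdef]
    exact radialCutoff_eq_zero hρ₂.le hρ₁ (le_of_lt (by simpa [hK, mem_closedBall_zero_iff] using hx))
  have hη0 : ∀ s, 0 ≤ η s := fun s => (hη01 s).1
  have hη1 : ∀ s, η s ≤ 1 := fun s => (hη01 s).2
  have hw0 : ∀ z, 0 ≤ w z := fun z =>
    mul_nonneg (mul_nonneg (Real.rpow_nonneg (hη0 _) _) (Real.rpow_nonneg (hV0 z) _))
      (pow_nonneg (hφ01 _).1 3)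
  have hg0 : ∀ z, 0 ≤ g z := fun z => by
    simp only [hg]
    exact mul_nonneg (mul_nonneg (by norm_num) (mul_nonneg (Real.rpow_nonneg (hη0 _) _)
      (Real.rpow_nonneg (hV0 z) _))) (norm_nonneg _)
  -- measurability
  have hηm : Measurable η := hη.continuous.measurable
  have hwm : Measurable w :=
    (((hηm.comp measurable_fst).pow_const _).mul (hVm.pow_const _)).mul
      ((hφc.measurable.comp measurable_snd).pow_const _)
  have hDφm : Measurable fun z : ℝ × EuclideanSpace ℝ (Fin 3) => ‖fderiv ℝ φ z.2‖ :=
    ((hφs.continuous_fderiv one_ne_zero).norm.measurable.comp measurable_snd)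
  have hgm : Measurable g :=
    (measurable_const.mul (((hηm.comp measurable_fst).pow_const _).mul (hVm.pow_const _))).mul hDφm
  have hUm : AEStronglyMeasurable (fun z : ℝ × EuclideanSpace ℝ (Fin 3) => U z.1 z.2) volume := hU
  ----------------------------------------------------------------
  -- Step 0: the energy bounds
  ----------------------------------------------------------------
  obtain ⟨hslice, hdiss⟩ := nu_moser_energy_bounds Φ U k R hΦm hΦ0 hEC hρ₂ hρ₁ hρ₁R ht₁ ht ht₀ hl hlk
    hq hφdef hLφ hη hη01 hBη0 hBη hinit
  ----------------------------------------------------------------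
  -- Step 1: `T < ∞` (`w ≤ l^{q/2}` is supported in `Q₁`, a set of finite measure)
  ----------------------------------------------------------------
  have hwle : ∀ z, w z ≤ l ^ (q / 2) := fun z => by
    have h1 : η z.1 ^ ((1 : ℝ) / 2) ≤ 1 := Real.rpow_le_one (hη0 _) (hη1 _) (by norm_num)
    have h2 : V z ^ (q / 2) ≤ l ^ (q / 2) :=
      Real.rpow_le_rpow (hV0 z) (hVl z) (by linarith)
    have h3 : φ z.2 ^ 3 ≤ 1 := pow_le_one₀ (hφ01 _).1 (hφ01 _).2
    have hab : η z.1 ^ ((1 : ℝ) / 2) * V z ^ (q / 2) ≤ 1 * l ^ (q / 2) :=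
      mul_le_mul h1 h2 (Real.rpow_nonneg (hV0 z) _) zero_le_one
    calc w z = η z.1 ^ ((1 : ℝ) / 2) * V z ^ (q / 2) * φ z.2 ^ 3 := rfl
      _ ≤ 1 * l ^ (q / 2) * 1 := mul_le_mul hab h3 (pow_nonneg (hφ01 _).1 3) (by positivity)
      _ = l ^ (q / 2) := by ring
  have hwK : ∀ z : ℝ × EuclideanSpace ℝ (Fin 3), z.2 ∉ K → w z = 0 := fun z hz => by
    simp only [hw, hφK z.2 hz]; ring
  have hTfin : T ≠ ∞ := by
    have hvol : volume Q₁ ≠ ∞ := by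
      rw [hQ₁, Measure.volume_eq_prod, Measure.prod_prod]
      exact ENNReal.mul_ne_top (by rw [Real.volume_Ioo]; exact ENNReal.ofReal_ne_top)
        measure_closedBall_lt_top.ne
    have hle : T ≤ ∫⁻ z in Qu, Q₁.indicator (fun _ => ENNReal.ofReal ((l ^ (q / 2)) ^ ((10 : ℝ) / 3))) z := by
      refine setLIntegral_mono' (measurableSet_Ioo.prod MeasurableSet.univ) fun z hz => ?_
      by_cases hz2 : z.2 ∈ K
      · rw [indicator_of_mem (show z ∈ Q₁ from ⟨hz.1, hz2⟩)]
        exact ENNReal.ofReal_le_ofReal (Real.rpow_le_rpow (hw0 z) (hwle z) (by norm_num))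
      · rw [hwK z hz2, Real.zero_rpow (by norm_num), ENNReal.ofReal_zero]; exact bot_le
    refine ne_top_of_le_ne_top ?_ hle
    rw [lintegral_indicator hQ₁m, setLIntegral_const]
    refine ENNReal.mul_ne_top ENNReal.ofReal_ne_top ?_
    exact ne_top_of_le_ne_top hvol (by
      rw [Measure.restrict_apply hQ₁m]; exact measure_mono inter_subset_left)
  ----------------------------------------------------------------
  -- Step 2: the embedding `T ≤ 3 C_S² E^{5/3}`
  ----------------------------------------------------------------
  set ν : Measure ℝ := volume.restrict (Ioo t₁ t₀) with hν
  set gs : ℝ → EuclideanSpace ℝ (Fin 3) → ℝ := fun s x => w (s, x) with hgs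
  obtain ⟨LΦ, hLΦ⟩ := hLip
  -- product-a.e. `z`: the slice `Φ z.1` is differentiable at `z.2` (Rademacher + joint continuity)
  have hνS : ∀ᵐ s ∂ν, s ∈ Iio (0 : ℝ) := by
    rw [hν, ae_restrict_iff' measurableSet_Ioo]
    exact ae_of_all _ fun s hs => lt_of_lt_of_le hs.2 ht₀
  have hcont' : ContinuousOn (uncurry Φ) (Iio (0 : ℝ) ×ˢ (univ : Set (EuclideanSpace ℝ (Fin 3)))) := by
    refine hcont.mono fun z hz => ?_
    exact (mem_prod.1 hz).1
  have haeΦ : ∀ᵐ z ∂(ν.prod (volume : Measure (EuclideanSpace ℝ (Fin 3)))),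
      DifferentiableAt ℝ (Φ z.1) z.2 :=
    ae_prod_differentiableAt_slice_of_continuousOn isOpen_Iio hcont' ν hνS
      (ae_of_all _ fun s => (hLΦ s).ae_differentiableAt)
  have haegs : ∀ᵐ z ∂(ν.prod (volume : Measure (EuclideanSpace ℝ (Fin 3)))),
      DifferentiableAt ℝ (gs z.1) z.2 := by
    filter_upwards [haeΦ] with z hz
    exact (sq_norm_fderiv_wSlice_le_of_differentiableAt hz hφs hφ01 hq l (hη0 z.1)).1
  -- every slice of `w` is Lipschitz: weak gradient = a.e. `fderiv`
  have hgsLip : ∀ s, ∃ Kw : ℝ≥0, LipschitzWith Kw (gs s) := fun s =>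
    exists_lipschitzWith_wSlice (hLΦ s) (hΦ0 s) hφs hφ01 hLφ hq hl (hη0 s)
  have hgsW : ∀ᵐ s ∂ν, Literature.Analysis.FunctionSpaces.HasWeakFDerivOn
      (⊤ : TopologicalSpace.Opens (EuclideanSpace ℝ (Fin 3))) volume (gs s) (fderiv ℝ (gs s)) :=
    ae_of_all _ fun s => by
      obtain ⟨Kw, hKw⟩ := hgsLip s
      exact hasWeakFDerivOn_of_lipschitz hKw ⊤
  -- slice `L²` finiteness
  have hgs2 : ∀ᵐ s ∂ν, eLpNorm (gs s) 2 (volume : Measure (EuclideanSpace ℝ (Fin 3))) < ∞ := by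
    refine ae_of_all _ fun s => ?_
    obtain ⟨Kw, hKw⟩ := hgsLip s
    have hcs : HasCompactSupport (gs s) := by
      refine HasCompactSupport.of_support_subset_isCompact (isCompact_closedBall (0 : EuclideanSpace ℝ (Fin 3)) ρ₁) ?_
      intro x hx
      by_contra hxK
      exact hx (hwK (s, x) hxK)
    exact (hKw.continuous.memLp_of_hasCompactSupport hcs).eLpNorm_lt_top
  -- slice `L²` bound `≤ E`
  have hM : ∀ᵐ s ∂ν, ∫⁻ x, ‖gs s x‖ₑ ^ 2 ≤ E := by
    rw [hν, ae_restrict_iff' measurableSet_Ioo]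
    refine ae_of_all _ fun s hsI => ?_
    have h := hslice s hsI
    have e : (fun x => ‖gs s x‖ₑ ^ 2) =
        fun x => ENNReal.ofReal (η s * max (l - Φ s x) 0 ^ q * (φ x ^ 3) ^ 2) := by
      funext x
      rw [Real.enorm_eq_ofReal (hw0 (s, x)), ← ENNReal.ofReal_pow (hw0 (s, x))]
      congr 1
      show (η s ^ ((1 : ℝ) / 2) * V (s, x) ^ (q / 2) * φ x ^ 3) ^ 2 = _
      rw [sq_w_rpow (hη0 s) (hV0 (s, x))]
      ring
    rw [e]; exact h
  -- slice gradient bound: `W s = ∫ ‖D(gs s)‖²` itself; its integral is controlled by the dissipation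
  set W : ℝ → ℝ≥0∞ := fun s => ∫⁻ x, ‖fderiv ℝ (gs s) x‖ₑ ^ 2 with hW
  have hDw_meas : AEStronglyMeasurable
      (fun z : ℝ × EuclideanSpace ℝ (Fin 3) => fderiv ℝ (gs z.1) z.2) (ν.prod volume) := by
    have hm : Measurable (uncurry gs) := by
      have : uncurry gs = w := by funext z; rfl
      rw [this]; exact hwm
    exact aestronglyMeasurable_fderiv_slice_of_ae_differentiableAt hm ν volume haegs
  have hWm : AEMeasurable W ν := (hDw_meas.enorm.pow_const _).lintegral_prod_right'
  have hWle : ∀ᵐ s ∂ν, ∫⁻ x, ‖fderiv ℝ (gs s) x‖ₑ ^ 2 ≤ W s := ae_of_all _ fun s => le_rfl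
  -- `∫ W ≤ 2·(dissipation) + 18 L_φ² I₁ ≤ 3 E`
  have hWint : ∫⁻ s, W s ∂ν ≤ 3 * E := by
    -- pointwise a.e. bound on the product
    have hprod : ∫⁻ s, W s ∂ν = ∫⁻ z, ‖fderiv ℝ (gs z.1) z.2‖ₑ ^ 2 ∂(ν.prod volume) := by
      rw [lintegral_prod _ (hDw_meas.enorm.pow_const _)]
    have hνprod : ν.prod (volume : Measure (EuclideanSpace ℝ (Fin 3))) = volume.restrict Qu := by
      rw [hν, hQu, Measure.restrict_prod_eq_prod_univ, ← Measure.volume_eq_prod]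
    have hae : ∀ᵐ z ∂(volume.restrict Qu),
        ‖fderiv ℝ (gs z.1) z.2‖ₑ ^ 2 ≤
          ENNReal.ofReal (η z.1 * (deriv (deriv fun τ : ℝ => max (l - τ) 0 ^ q) (Φ z.1 z.2) *
            ‖gradient (Φ z.1) z.2‖ ^ 2 * (φ z.2 ^ 3) ^ 2)) +
          Q₁.indicator (fun z => ENNReal.ofReal (18 * Lφ ^ 2) * ENNReal.ofReal (V z ^ q)) z := by
      have hmem : ∀ᵐ z ∂(volume.restrict Qu), z ∈ Qu :=
        ae_restrict_mem (measurableSet_Ioo.prod MeasurableSet.univ)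
      have haeQ : ∀ᵐ z ∂(volume.restrict Qu), DifferentiableAt ℝ (Φ z.1) z.2 := by
        rw [← hνprod]; exact haeΦ
      filter_upwards [haeQ, hmem] with z hz hzQu
      obtain ⟨-, h1⟩ := sq_norm_fderiv_wSlice_le_of_differentiableAt hz hφs hφ01 hq l (hη0 z.1)
      have hA0 : 0 ≤ η z.1 * (deriv (deriv fun τ : ℝ => max (l - τ) 0 ^ q) (Φ z.1 z.2) *
          ‖gradient (Φ z.1) z.2‖ ^ 2 * (φ z.2 ^ 3) ^ 2) :=
        mul_nonneg (hη0 _) (mul_nonneg (mul_nonneg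
          (deriv_deriv_posPart_const_sub_rpow_nonneg hq l _) (sq_nonneg _)) (sq_nonneg _))
      rw [← ofReal_norm, ← ENNReal.ofReal_pow (norm_nonneg _)]
      by_cases hzK : z.2 ∈ K
      · rw [indicator_of_mem (show z ∈ Q₁ from ⟨hzQu.1, hzK⟩),
          ← ENNReal.ofReal_mul (by positivity), ← ENNReal.ofReal_add hA0
            (mul_nonneg (by positivity) (Real.rpow_nonneg (hV0 z) _))]
        refine ENNReal.ofReal_le_ofReal (h1.trans ?_)
        have : 18 * η z.1 * V z ^ q * ‖fderiv ℝ φ z.2‖ ^ 2 ≤ 18 * Lφ ^ 2 * V z ^ q := by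
          have hD : ‖fderiv ℝ φ z.2‖ ^ 2 ≤ Lφ ^ 2 := pow_le_pow_left₀ (norm_nonneg _) (hLφ _) 2
          have hVq : 0 ≤ V z ^ q := Real.rpow_nonneg (hV0 z) _
          calc 18 * η z.1 * V z ^ q * ‖fderiv ℝ φ z.2‖ ^ 2 ≤ 18 * 1 * V z ^ q * Lφ ^ 2 :=
                mul_le_mul (mul_le_mul_of_nonneg_right (by linarith [hη1 z.1]) hVq) hD (sq_nonneg _)
                  (by positivity)
            _ = 18 * Lφ ^ 2 * V z ^ q := by ring
        linarith
      · have hD0 : fderiv ℝ φ z.2 = 0 := by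
          have : z.2 ∉ tsupport φ := fun h => hzK (by
            rw [hφdef] at h; exact tsupport_radialCutoff_subset hρ₂.le hρ₁ h)
          exact fderiv_of_notMem_tsupport ℝ this
        rw [indicator_of_notMem (fun h : z ∈ Q₁ => hzK h.2), add_zero]
        refine ENNReal.ofReal_le_ofReal (h1.trans ?_)
        rw [hD0, norm_zero]
        linarith
    rw [hprod, hνprod]
    calc ∫⁻ z in Qu, ‖fderiv ℝ (gs z.1) z.2‖ₑ ^ 2
        ≤ ∫⁻ z in Qu, (ENNReal.ofReal (η z.1 * (deriv (deriv fun τ : ℝ => max (l - τ) 0 ^ q)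
            (Φ z.1 z.2) * ‖gradient (Φ z.1) z.2‖ ^ 2 * (φ z.2 ^ 3) ^ 2)) +
            Q₁.indicator (fun z => ENNReal.ofReal (18 * Lφ ^ 2) * ENNReal.ofReal (V z ^ q)) z) :=
          lintegral_mono_ae hae
      _ = (∫⁻ z in Qu, ENNReal.ofReal (η z.1 * (deriv (deriv fun τ : ℝ => max (l - τ) 0 ^ q)
            (Φ z.1 z.2) * ‖gradient (Φ z.1) z.2‖ ^ 2 * (φ z.2 ^ 3) ^ 2))) +
            ∫⁻ z in Qu, Q₁.indicator
              (fun z => ENNReal.ofReal (18 * Lφ ^ 2) * ENNReal.ofReal (V z ^ q)) z :=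
          lintegral_add_right' _
            ((((hVm.pow_const _).ennreal_ofReal.const_mul _).indicator hQ₁m).aemeasurable)
      _ ≤ 2 * E + ENNReal.ofReal (18 * Lφ ^ 2) * I₁ := by
          gcongr ?_ + ?_
          · -- twice the dissipation
            have e2 : (fun z : ℝ × EuclideanSpace ℝ (Fin 3) => ENNReal.ofReal (η z.1 *
                (deriv (deriv fun τ : ℝ => max (l - τ) 0 ^ q) (Φ z.1 z.2) *
                  ‖gradient (Φ z.1) z.2‖ ^ 2 * (φ z.2 ^ 3) ^ 2))) =
                fun z => 2 * ENNReal.ofReal (1 / 2 * η z.1 *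
                  (deriv (deriv fun τ : ℝ => max (l - τ) 0 ^ q) (Φ z.1 z.2) *
                    ‖gradient (Φ z.1) z.2‖ ^ 2 * (φ z.2 ^ 3) ^ 2)) := by
              funext z
              rw [ofReal_eq_two_mul_ofReal_half]
              congr 2; ring
            rw [e2, lintegral_const_mul' _ _ (by norm_num)]
            gcongr
          · -- the `|Dφ|²` term lives on `Q₁ ⊆ Qu`
            rw [lintegral_indicator hQ₁m, Measure.restrict_restrict hQ₁m,
              inter_eq_left.2 (prod_mono le_rfl (subset_univ _)),
              lintegral_const_mul' _ _ ENNReal.ofReal_ne_top]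
      _ ≤ 3 * E := by
          have h36 : ENNReal.ofReal (18 * Lφ ^ 2) * I₁ ≤ E := by
            calc ENNReal.ofReal (18 * Lφ ^ 2) * I₁ ≤ ENNReal.ofReal (36 * Lφ ^ 2 + Bη) * I₁ := by
                  gcongr; linarith [sq_nonneg Lφ]
              _ ≤ E := le_self_add
          calc 2 * E + ENNReal.ofReal (18 * Lφ ^ 2) * I₁ ≤ 2 * E + E := add_le_add le_rfl h36
            _ = 3 * E := by ring
  -- the embedding
  have hEmb := parabolicEmbedding_of_hasWeakFDerivOn ν gs (fun s => fderiv ℝ (gs s)) E W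
    ((10 : ℝ) / 3) ((10 : ℝ) / 3) 1 hgsW hgs2 hM hWm hWle (by norm_num) (by norm_num) (by norm_num)
    (by norm_num) le_rfl
  have hνprod' : ν.prod (volume : Measure (EuclideanSpace ℝ (Fin 3))) = volume.restrict Qu := by
    rw [hν, hQu, Measure.restrict_prod_eq_prod_univ, ← Measure.volume_eq_prod]
  have hT_eq : T = ∫⁻ s, (∫⁻ x, ‖gs s x‖ₑ ^ ((10 : ℝ) / 3)) ∂ν := by
    have e1 : T = ∫⁻ z in Qu, ‖w z‖ₑ ^ ((10 : ℝ) / 3) := by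
      refine lintegral_congr fun z => ?_
      rw [Real.enorm_eq_ofReal (hw0 z), ENNReal.ofReal_rpow_of_nonneg (hw0 z) (by norm_num)]
    rw [e1, ← hνprod', lintegral_prod _ (hwm.enorm.pow_const _).aemeasurable]
  have hT_le : T ≤ 3 * CS ^ 2 * E ^ ((5 : ℝ) / 3) := by
    have h1 : ∫⁻ s, (∫⁻ x, ‖gs s x‖ₑ ^ ((10 : ℝ) / 3)) ∂ν ≤
        E ^ ((2 : ℝ) / 3) * (CS ^ 2 * ∫⁻ s, W s ∂ν) := by
      have e : (fun s => (∫⁻ x, ‖gs s x‖ₑ ^ ((10 : ℝ) / 3)) ^ (((10 : ℝ) / 3) / ((10 : ℝ) / 3))) =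
          fun s => (∫⁻ x, ‖gs s x‖ₑ ^ ((10 : ℝ) / 3)) := by
        funext s
        rw [div_self (by norm_num), ENNReal.rpow_one]
      rw [e] at hEmb
      refine hEmb.trans (le_of_eq ?_)
      rw [show ((10 : ℝ) / 3) / 2 - 1 = (2 : ℝ) / 3 by norm_num, sub_self, ENNReal.rpow_zero,
        mul_one, ENNReal.rpow_one]
    rw [hT_eq]
    calc ∫⁻ s, (∫⁻ x, ‖gs s x‖ₑ ^ ((10 : ℝ) / 3)) ∂ν
        ≤ E ^ ((2 : ℝ) / 3) * (CS ^ 2 * ∫⁻ s, W s ∂ν) := h1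
      _ ≤ E ^ ((2 : ℝ) / 3) * (CS ^ 2 * (3 * E)) := by gcongr
      _ = 3 * CS ^ 2 * (E ^ ((2 : ℝ) / 3) * E ^ (1 : ℝ)) := by rw [ENNReal.rpow_one]; ring
      _ = 3 * CS ^ 2 * E ^ ((5 : ℝ) / 3) := by
          rw [← ENNReal.rpow_add_of_nonneg _ _ (by norm_num) (by norm_num)]; norm_num
  exact ⟨hTfin, hT_le⟩

end Summit.NavierStokesRegularity.NavierStokesRegularity.Theorems.AveragedConeLiouville.NU

end
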